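import Literature.Geometry.Kaehler.ComplexTorusNonSimpleAbelianFourfoldStablyNondegenerate
import HarnessLib

/-!
# Moonen–Zarhin 1999 Thm. (0.2) (4) for the complex abelian FIVEFOLDS all of whose simple factors have dimension `≤ 2`:
# `Y × E₁ × E₂ × E₃` and `(Y₁ × Y₂) × E` satisfy condition (D) — `ℬ•(Xⁿ) = 𝒟•(Xⁿ)` for all `n` — and `Hg(X) = Sp_D(V,φ)`,
# for ALL polarised abelian surfaces `Y`, `Y₁`, `Y₂` and ALL elliptic curves `E`, `E_i` (no exceptional case)

Layer `Literature/Geometry/Kaehler`, namespace `Literature.Geometry.Kaehler.ComplexTorus`; lane `lit-hodgefound` (Track 2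
foundations library), Layer A4 (known cases of `ℬ = 𝒟`); prover seat `lit-hodgefound-p17`, generation 55, self-proposed row
g55-#1 — the first dimension-`5` POSITIVE row of the seat's Moonen–Zarhin programme (generation 54 landed the dimension-`5`
NEGATIVE cases (e), (f), (g): `ComplexTorusAbelianFivefoldCasesEFDegenerate`, `ComplexTorusAbelianFivefoldCaseGDegenerate`).
THEOREMS ONLY (no definition, no instance, no notation, no named fact; D-0026 net debt `0`).

## Source, VERBATIM (held `paper:arxiv-math_9901113`; the held text carries no statement numbers, locators are page ∕ line
## of the materialisation)

B. J. J. Moonen, Yu. G. Zarhin [MoonenZarhin1999LowDim], *Hodge classes on abelian varieties of low dimension*, Math. Ann.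
**315** (1999) 711–733.  Thm. (0.2) (p0001 L144–p0002 L8): «Let `X` be a complex abelian variety of dimension 5. … (4) Suppose
we are not in one of the cases (e), (f) or (g). Decompose `X`, up to isogeny, as a product of elementary abelian varieties,
say `X ∼ Y₁^{m₁} × ⋯ × Y_r^{m_r}`. Then `Hg(X) = Hg(Y₁^{m₁}) × ⋯ Hg(Y_r^{m_r})`. For every `n ≥ 1` the Hodge ring `ℬ•(Xⁿ)` is
generated by the images of the Hodge rings `ℬ•(Y_j^{m_j})`. In particular, if `X` has no simple factor of dimension 4 then
`Hg(X) = Sp_D(V,φ)` and `ℬ•(Xⁿ) = 𝒟•(Xⁿ)` for every `n ≥ 1`.»  The cases (p0001 L127–L140): «(e) The abelian variety `X` is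
isogenous to a product `X₁² × X₂`, where `X₁` and `X₂` are as in (a). (f) The abelian variety `X` is isogenous to a product
`X₀ × X₁ × X₂`, where `X₀` is an elliptic curve, where `X₁` and `X₂` are as in (a), and such that `X₀` and `X₁` are not
isogenous. (g) … `X₂` is a simple abelian fourfold …» — each of (e), (f), (g) has a SIMPLE factor of dimension `3` or `4`
(in (a), «`X₂` is a simple abelian threefold»), so a fivefold all of whose simple factors have dimension `≤ 2` is in none of
them and has no simple factor of dimension `4`: for it Thm. (0.2) (4) asserts `Hg(X) = Sp_D(V,φ)` and `ℬ•(Xⁿ) = 𝒟•(Xⁿ)`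
unconditionally.  The proof, §5 (5.6)–(5.12) (p0009 L110 – p0011 L12): «we can assume that every simple factor of `X` occurs
with multiplicity 1» (p0009 L113–L114; Hazama's power remark, (3.1) p0006 L53–L65); (5.11) (p0010 L47–L56): «Write
`X ∼ E × Y`, where `E` is an elliptic curve and `dim(Y) = 4`. Without loss of generality we may assume that `Hom(E,Y) = 0`.
(If not then we are reduced to the case `dim(X) ≤ 4`.) … If `d_max ≤ 2` then all simple factors of `Y` are of CM-type and
there does not exist an embedding of `End⁰(E)` into the center of `End⁰(Y)`. Then Proposition (3.8) gives `Hg(X) = Hg(E) ×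
Hg(Y)`.»; Prop. (3.8) (p0007 L55–L59): «Let `X` be an abelian variety and let `E` be an elliptic curve, both over `ℂ`. Suppose
`Hom(E,X) = 0`. Then either `Hg(X × E) = Hg(X) × Hg(E)` or `End⁰(E) = k` is an imaginary quadratic field such that there
exists an embedding of `k` into the center of `End⁰(X)`.»; Cor. (3.9) (p0007 L80–L84): «every product of elliptic curves
satisfies condition (D)»; (3.4) for an elliptic curve with `End⁰ = ℚ` (p0006 L100–L105, p0007 L61).

* B. B. Gordon [Gordon1999HodgeAVSurvey], *A survey of the Hodge conjecture for abelian varieties*, Thm. 7.5 (1) ⟺ (2)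
  (stably nondegenerate ⟺ `Hg = Lf`), 7.6.1–7.6.2 (products, powers, abelian subvarieties of stably nondegenerate ones).
* J. S. Milne [Milne1999LefschetzClasses], Duke Math. J. **96** (1999), §4 Prop. 4.8.
* H. Lange [Lange2023AbelianVarietiesComplex], *Abelian Varieties over the Complex Numbers* (2023), §1.1.2 Cor. 1.1.16
  (isogeny is an equivalence relation; products), §2.4.4 Thm. 2.4.25 ∕ Cor. 2.4.26 (Poincaré; `End_ℚ` of a product),
  §5.1.5 Exercise (1) (`End_ℚ` of an elliptic curve).

## The argument (Moonen–Zarhin's, run with the tree's instruments)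

`X = ((Y × E₁) × E₂) × E₃`, `Y` a polarised abelian surface.  `Y` NOT simple: `Y ∼ E_{σ₀} × E_{σ₁}` and `X` is isogenous to a
product of five elliptic curves — Cor. (3.9) (the tree's `IsIsogenous.forall_divisorClasses_powPeriod_eq_hodgeClasses_of_pi_ellipticPeriod`).
`Y` SIMPLE: `E₃` without complex multiplication — (3.4) ∕ the tree's non-CM elliptic factor theorem on the stably nondegenerate
fourfold `(Y × E₁) × E₂` (g51-#6, hypothesis-free); two of the three curves isogenous — «reduced to the case `dim(X) ≤ 4`»:
`X ∼ (Y × E_j) × E_k²`, stably nondegenerate with `(Y × E_j) × E_k` (Hazama's power remark); otherwise `E₃` has complex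
multiplication by `k = ℚ(τ₃)` and `Hom(E₃, (Y × E₁) × E₂) = 0`: by (3.8) — the tree's CM half
`IsAbelianVariety.exists_algHom_center_endAlgRat_or_isIsogenous_of_hodgeGroupC_prod_ellipticPeriod_prod_ellipticPeriod_ne` and
the factorisation of characters of `Z(End⁰(Y × E₁)) = Z(End⁰ Y) × End⁰(E₁)` — a non-split `Hg(X)` would embed `k` into
`Z(End⁰ Y)` (impossible for a simple surface: the tree's `IsSimple.im_eq_zero_of_sq_add_eq_zero_of_finrank_eq_two`, «there
does not exist an embedding of `End⁰(E)` into the center of `End⁰(Y)`») or into `End⁰(E₁)` ∕ `End⁰(E₂)` (then `E₁ ∼ E₃` ∕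
`E₂ ∼ E₃`, excluded); so `Hg(X) = Hg((Y × E₁) × E₂) × Hg(E₃)` and (D) transfers from the factors ((3.1), Gordon 7.6.2).
`X = (Y₁ × Y₂) × E`: a non-simple `Y_i ∼ E_a × E_b` brings us to the previous shape; `Y₁ ∼ Y₂` gives `X ∼ E × Y₂²`, stably
nondegenerate with `E × Y₂`; two non-isogenous simple surfaces have `End⁰(Y₁ × Y₂) = End⁰(Y₁) × End⁰(Y₂)` and neither centre
receives `k`, so (3.8) splits `Hg(X) = Hg(Y₁ × Y₂) × Hg(E)` and (D) transfers from `Y₁ × Y₂` (Thm. (0.1) (4) for two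
surfaces, the tree's g53 assembly) and `E`.  `Hg(X) = Sp_D(V,φ)` then follows from (D) by Gordon's Thm. 7.5 (the tree's A4-103).

## What is proved

* §1 **`IsSimple.hodgeGroupC_prod_ellipticPeriod_prod_ellipticPeriod_prod_ellipticPeriod_eq_blockDiagProd`** ((3.8) ⟹
  `Hg(((Y × E₁) × E₂) × E₃)(ℂ) = Hg((Y × E₁) × E₂)(ℂ) × Hg(E₃)(ℂ)` for `Y` simple, `E₃` CM, the three curves pairwise
  non-isogenous); **`IsRiemannForm.forall_divisorClasses_powPeriod_prod_ellipticPeriod_prod_ellipticPeriod_prod_ellipticPeriod_eq_hodgeClasses_of_finrank_eq_two`**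
  (`((Y × E_{τ₁}) × E_{τ₂}) × E_{τ₃}` satisfies (D) for EVERY polarised surface `Y` and ALL `τ₁, τ₂, τ₃`), with `IsSimple.`,
  `IsAbelianVariety.` and isogeny forms (`IsIsogenous.…_of_prod_prod_prod_of_finrank_eq_one`: `X ∼ ((Y × C₁) × C₂) × C₃` with
  `C_i` one-dimensional complex tori).
* §2 **`IsSimple.hodgeGroupC_prod_prod_ellipticPeriod_eq_blockDiagProd_of_not_isIsogenous`** (two non-isogenous simple
  surfaces and a CM curve: `Hg((Y₁ × Y₂) × E)(ℂ) = Hg(Y₁ × Y₂)(ℂ) × Hg(E)(ℂ)`);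
  **`IsRiemannForm.forall_divisorClasses_powPeriod_prod_prod_ellipticPeriod_eq_hodgeClasses_of_finrank_eq_two_two`**
  (`(Y₁ × Y₂) × E_τ` satisfies (D) for ALL polarised surfaces `Y₁, Y₂` and every `τ`), `IsAbelianVariety.` and isogeny forms.
* §3 «`Hg(X) = Sp_D(V,φ)`» (real points `Hg(X)(ℝ) = S(X)(ℝ)` for any polarisation of `X`) for every polarised `X` isogenous to
  one of the two shapes: `IsRiemannForm.hodgeGroup_eq_lefschetzGroup_of_isIsogenous_prod_prod_prod_of_finrank_eq_one`,
  `IsRiemannForm.hodgeGroup_eq_lefschetzGroup_of_isIsogenous_prod_prod_of_finrank_eq_two_two_one`.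
-/

noncomputable section

open Module Matrix Complex Function

namespace Literature.Geometry.Kaehler

namespace ComplexTorus

/-! ### §0 Plumbing: products of elliptic curves as `piPeriod`, shuffles of triple products, Hazama's power remark -/

section Plumbing

/-- `E_τ = E_{τ'}` as period presentations when `τ = τ'`. [folklore] -/
private theorem ellipticPeriod_congr₅₅ {τ τ' : ℂ} {hτ : τ.im ≠ 0} {hτ' : τ'.im ≠ 0} (h : τ = τ') :
    ellipticPeriod hτ = ellipticPeriod hτ' := by
  subst h
  rfl

/-- The family `(σ₀, …, σ_{N−1}, τ)` of non-real periods. [folklore] -/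
private theorem forall_im_snoc_ne_zero₅₅ {N : ℕ} {σ : Fin N → ℂ} (hσ : ∀ k, (σ k).im ≠ 0) {τ : ℂ} (hτ : τ.im ≠ 0) :
    ∀ k, ((Fin.snoc σ τ : Fin (N + 1) → ℂ) k).im ≠ 0 := fun k ↦ by
  induction k using Fin.lastCases with
  | last => rwa [Fin.snoc_last]
  | cast i => rw [Fin.snoc_castSucc]; exact hσ i

/-- `X × E_τ ∼ E_{ρ₀} × ⋯ × E_{ρ_N}` when `X ∼ E_{ρ₀} × ⋯ × E_{ρ_{N-1}}` and `ρ_N = τ`.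
[cite: Lange2023AbelianVarietiesComplex, §1.1.2 (products, p. 21) and Cor. 1.1.16] -/
private theorem isIsogenous_prod_ellipticPeriod_piPeriod_snoc₅₅ {ι : Type*} [Fintype ι] [DecidableEq ι] {F : Type*}
    [NormedAddCommGroup F] [NormedSpace ℂ F] {Φ : (ι → ℝ) ≃L[ℝ] F} {N : ℕ} {σ : Fin N → ℂ} (hσ : ∀ k, (σ k).im ≠ 0)
    {τ : ℂ} (hτ : τ.im ≠ 0) (h : IsIsogenous Φ (piPeriod fun k ↦ ellipticPeriod (hσ k))) :
    IsIsogenous (prodPeriod Φ (ellipticPeriod hτ))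
      (piPeriod fun k ↦ ellipticPeriod (forall_im_snoc_ne_zero₅₅ hσ hτ k)) := by
  have hρ := forall_im_snoc_ne_zero₅₅ hσ hτ
  have hfam : (fun k ↦ ellipticPeriod (hσ k)) = fun k : Fin N ↦ ellipticPeriod (hρ k.castSucc) :=
    funext fun k ↦ ellipticPeriod_congr₅₅ (by simp)
  rw [hfam] at h
  exact IsIsogenous.trans _ _ _ (h.prod (IsIsogenous.refl (ellipticPeriod hτ)))
    (isIsomorphic_prodPeriod_piPeriod_ellipticPeriod_castSucc hρ hτ (by rw [Fin.snoc_last])).isIsogenous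

variable {ι₁ ι₂ ι₃ : Type*} [Fintype ι₁] [Fintype ι₂] [Fintype ι₃] [DecidableEq ι₁] [DecidableEq ι₂] [DecidableEq ι₃]
  {F₁ F₂ F₃ : Type*} [NormedAddCommGroup F₁] [NormedSpace ℂ F₁] [NormedAddCommGroup F₂] [NormedSpace ℂ F₂]
  [NormedAddCommGroup F₃] [NormedSpace ℂ F₃]

/-- **`(A × B) × C ≅ (A × C) × B`.** [cite: Lange2023AbelianVarietiesComplex, §1.1.2 (products, p. 21)] -/
private theorem isIsomorphic_prod_prod_swap₅₅ (A : (ι₁ → ℝ) ≃L[ℝ] F₁) (B : (ι₂ → ℝ) ≃L[ℝ] F₂) (C : (ι₃ → ℝ) ≃L[ℝ] F₃) :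
    IsIsomorphic (prodPeriod (prodPeriod A B) C) (prodPeriod (prodPeriod A C) B) :=
  ((isIsomorphic_prodPeriod_assoc A B C).trans ((IsIsomorphic.refl A).prod (isIsomorphic_prodPeriod_comm B C))).trans
    (isIsomorphic_prodPeriod_assoc A C B).symm

omit [Fintype ι₃] [DecidableEq ι₃] [NormedAddCommGroup F₃] [NormedSpace ℂ F₃] in
/-- **`Hom_ℚ(X₁ × X₂, Z) = 0 ⟺ Hom_ℚ(X₁, Z) = 0` and `Hom_ℚ(X₂, Z) = 0`** (`Hom(X₁ × X₂, Z) = Hom(X₁, Z) ⊕ Hom(X₂, Z)`, the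
tree's `finrank_homRat_prod_left`). [cite: Lange2023AbelianVarietiesComplex, §2.4.4 Cor. 2.4.26 (proof, p. 124) and §1.1.2] -/
private theorem homRat_prod_left_eq_bot_iff₅₅ {ι : Type*} [Fintype ι] [DecidableEq ι] {F : Type*} [NormedAddCommGroup F]
    [NormedSpace ℂ F] (A : (ι₁ → ℝ) ≃L[ℝ] F₁) (B : (ι₂ → ℝ) ≃L[ℝ] F₂) (Θ : (ι → ℝ) ≃L[ℝ] F) :
    homRat (prodPeriod A B) Θ = ⊥ ↔ homRat A Θ = ⊥ ∧ homRat B Θ = ⊥ := by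
  rw [← Submodule.finrank_eq_zero, ← Submodule.finrank_eq_zero, ← Submodule.finrank_eq_zero,
    finrank_homRat_prod_left A B Θ]
  omega

omit [Fintype ι₂] [Fintype ι₃] [DecidableEq ι₂] [DecidableEq ι₃] [NormedAddCommGroup F₂] [NormedSpace ℂ F₂]
  [NormedAddCommGroup F₃] [NormedSpace ℂ F₃] in
/-- **Hazama's power remark for two isogenous elliptic factors: `Z × E_ρ` stably nondegenerate and `E_σ ∼ E_ρ` ⟹
`Z × (E_σ × E_ρ)` stably nondegenerate** (`Z × (E_σ × E_ρ) ∼ Z × E_ρ²`, «we can assume that every simple factor of `X` occurs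
with multiplicity 1»). [cite: MoonenZarhin1999LowDim, §5 (p0009 L113–L114) and §3 (3.1) (p0006 L53–L65)] [cite: Gordon1999HodgeAVSurvey, 7.6.1–7.6.2] -/
private theorem forall_divisorClasses_powPeriod_prod_prod_eq_hodgeClasses_of_isIsogenous₅₅ {Θ : (ι₁ → ℝ) ≃L[ℝ] F₁}
    (hA : IsAbelianVariety Θ) {σ ρ : ℂ} (hσ : σ.im ≠ 0) (hρ : ρ.im ≠ 0)
    (h : IsIsogenous (ellipticPeriod hσ) (ellipticPeriod hρ))
    (hSN : ∀ k p, divisorClasses (powPeriod (prodPeriod Θ (ellipticPeriod hρ)) k) p =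
      hodgeClasses (powPeriod (prodPeriod Θ (ellipticPeriod hρ)) k) p) :
    ∀ k p, divisorClasses (powPeriod (prodPeriod Θ (prodPeriod (ellipticPeriod hσ) (ellipticPeriod hρ))) k) p =
      hodgeClasses (powPeriod (prodPeriod Θ (prodPeriod (ellipticPeriod hσ) (ellipticPeriod hρ))) k) p :=
  ((IsIsogenous.refl Θ).prod (h.prod_powPeriod_two (IsIsogenous.refl (ellipticPeriod hρ))))
    |>.forall_powPeriod_divisorClasses_eq_hodgeClasses_iff.2
      (hA.forall_divisorClasses_powPeriod_prod_powPeriod_eq_hodgeClasses_of_prod (isAbelianVariety_ellipticPeriod hρ) hSN 2)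

end Plumbing

/-! ### §0' No character of the centre of `End⁰(Y)`, `Y` a simple abelian surface, takes an imaginary quadratic value -/

section SimpleSurfaceCentre

variable {κ : Type} [Fintype κ] [DecidableEq κ] {E : Type} [NormedAddCommGroup E] [NormedSpace ℂ E]
  [FiniteDimensional ℂ E] {Ψ : (κ → ℝ) ≃L[ℝ] E} {η : E [⋀^Fin 2]→L[ℝ] ℝ} {τ : ℂ} (hτ : τ.im ≠ 0)

/-- **`k = ℚ(τ) = End⁰(E_τ)` (`E_τ` with complex multiplication) does not embed into the centre of `End⁰(Y)` for a simple
abelian surface `Y`**: no `ℚ`-algebra character of `Z(End⁰ Y)` takes the value `τ` («all simple factors of `Y` are of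
CM-type and there does not exist an embedding of `End⁰(E)` into the center of `End⁰(Y)`»; for a non-CM simple surface the
centre is totally real).  The tree's `IsSimple.im_eq_zero_of_sq_add_eq_zero_of_finrank_eq_two`, repackaged.
[cite: MoonenZarhin1999LowDim, §5 (5.11) (p0010 L53–L56) and (5.2) (p0008 L101–L105)] -/
theorem IsSimple.not_mem_range_algHom_center_endAlgRat_of_finrank_eq_two (hY : IsSimple Ψ) (hη : IsRiemannForm Ψ η)
    (h2 : finrank ℂ E = 2) (hCM : ellipticEnd hτ ≠ ⊥) (χ : Subalgebra.center ℚ (endAlgRat Ψ) →ₐ[ℚ] ℂ) :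
    τ ∉ χ.range := by
  haveI : Nonempty κ := Fintype.card_pos_iff.1 (by rw [card_eq_two_mul_finrank Ψ, h2]; norm_num)
  intro hτχ
  obtain ⟨c, hc⟩ := (AlgHom.mem_range χ).1 hτχ
  obtain ⟨p, q, hpq⟩ := (ellipticEnd_ne_bot_iff hτ).1 hCM
  obtain ⟨φ, hφ⟩ : ∃ φ : centerField Ψ hY →+* ℂ, ∀ x, φ x = χ x := ⟨χ.toRingHom, fun _ ↦ rfl⟩
  have hc' : φ c = τ := (hφ c).trans hc
  have him := hY.im_eq_zero_of_sq_add_eq_zero_of_finrank_eq_two hη h2 φ c (p := p) (q := q) (by rw [hc']; exact hpq)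
  rw [hc'] at him
  exact hτ him

end SimpleSurfaceCentre

/-! ## §1 `((Y × E₁) × E₂) × E₃` for an abelian surface `Y` and three elliptic curves -/

section SurfaceThreeCurves

variable {κ : Type} [Fintype κ] [DecidableEq κ] {E : Type} [NormedAddCommGroup E] [NormedSpace ℂ E]
  [FiniteDimensional ℂ E] {Ψ : (κ → ℝ) ≃L[ℝ] E} {η : E [⋀^Fin 2]→L[ℝ] ℝ} {τ₁ τ₂ τ₃ : ℂ} (hτ₁ : τ₁.im ≠ 0)
  (hτ₂ : τ₂.im ≠ 0) (hτ₃ : τ₃.im ≠ 0)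

/-- **MOONEN–ZARHIN (5.11) WITH `d_max ≤ 2`, THE HODGE GROUP: for a SIMPLE abelian surface `Y`, pairwise NON-ISOGENOUS elliptic
curves `E₁, E₂, E₃` and `E₃` WITH complex multiplication, `Hg(((Y × E₁) × E₂) × E₃)(ℂ) = Hg((Y × E₁) × E₂)(ℂ) × Hg(E₃)(ℂ)`**
— `Hom(E₃, (Y × E₁) × E₂) = 0` and `k = End⁰(E₃)` embeds neither into `Z(End⁰ Y)` nor into `End⁰(E₁)`, `End⁰(E₂)` (that
would make `E₁ ∼ E₃` ∕ `E₂ ∼ E₃`), so «Proposition (3.8) gives `Hg(X) = Hg(E) × Hg(Y)`».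
[cite: MoonenZarhin1999LowDim, §5 (5.11) (p0010 L47–L56) and §3 Prop. (3.8) (p0007 L55–L74)] [cite: Lange2023AbelianVarietiesComplex, §2.4.4 Cor. 2.4.26 and §5.1.5 Exercise (1)] -/
theorem IsSimple.hodgeGroupC_prod_ellipticPeriod_prod_ellipticPeriod_prod_ellipticPeriod_eq_blockDiagProd (hY : IsSimple Ψ)
    (hη : IsRiemannForm Ψ η) (h2 : finrank ℂ E = 2) (hCM : ellipticEnd hτ₃ ≠ ⊥)
    (h₁₂ : ¬ IsIsogenous (ellipticPeriod hτ₁) (ellipticPeriod hτ₂))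
    (h₁₃ : ¬ IsIsogenous (ellipticPeriod hτ₁) (ellipticPeriod hτ₃))
    (h₂₃ : ¬ IsIsogenous (ellipticPeriod hτ₂) (ellipticPeriod hτ₃)) :
    hodgeGroupC (prodPeriod (prodPeriod (prodPeriod Ψ (ellipticPeriod hτ₁)) (ellipticPeriod hτ₂)) (ellipticPeriod hτ₃)) =
      blockDiagProd (hodgeGroupC (prodPeriod (prodPeriod Ψ (ellipticPeriod hτ₁)) (ellipticPeriod hτ₂)))
        (hodgeGroupC (ellipticPeriod hτ₃)) := by
  haveI : Nonempty κ := Fintype.card_pos_iff.1 (by rw [card_eq_two_mul_finrank Ψ, h2]; norm_num)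
  have hcard : Fintype.card κ ≠ Fintype.card (Fin 2) := by
    rw [card_eq_two_mul_finrank Ψ, h2, Fintype.card_fin]; norm_num
  by_contra hne
  -- `Hom(Y × E₁, E₂) = 0 = Hom(E₂, Y × E₁)`
  have hY2 : homRat Ψ (ellipticPeriod hτ₂) = ⊥ := hY.homRat_eq_bot_of_card_ne (isSimple_ellipticPeriod hτ₂) hcard
  have h2Y : homRat (ellipticPeriod hτ₂) Ψ = ⊥ :=
    (isSimple_ellipticPeriod hτ₂).homRat_eq_bot_of_card_ne hY fun h ↦ hcard h.symm
  have hE12 : homRat (ellipticPeriod hτ₁) (ellipticPeriod hτ₂) = ⊥ :=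
    (isSimple_ellipticPeriod hτ₁).homRat_eq_bot (isSimple_ellipticPeriod hτ₂) h₁₂
  have hE21 : homRat (ellipticPeriod hτ₂) (ellipticPeriod hτ₁) = ⊥ :=
    (isSimple_ellipticPeriod hτ₂).homRat_eq_bot (isSimple_ellipticPeriod hτ₁) fun h ↦ h₁₂ (IsIsogenous.symm _ _ h)
  have h₁₂' : homRat (prodPeriod Ψ (ellipticPeriod hτ₁)) (ellipticPeriod hτ₂) = ⊥ :=
    (homRat_prod_left_eq_bot_iff₅₅ Ψ (ellipticPeriod hτ₁) (ellipticPeriod hτ₂)).2 ⟨hY2, hE12⟩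
  have h₂₁' : homRat (ellipticPeriod hτ₂) (prodPeriod Ψ (ellipticPeriod hτ₁)) = ⊥ :=
    (homRat_prod_right_eq_bot_iff Ψ (ellipticPeriod hτ₁) (ellipticPeriod hτ₂)).2 ⟨h2Y, hE21⟩
  -- `Hom(Y, E₁) = 0 = Hom(E₁, Y)` for the factorisation of the centre of `End⁰(Y × E₁)`
  have hY1 : homRat Ψ (ellipticPeriod hτ₁) = ⊥ := hY.homRat_eq_bot_of_card_ne (isSimple_ellipticPeriod hτ₁) hcard
  have h1Y : homRat (ellipticPeriod hτ₁) Ψ = ⊥ :=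
    (isSimple_ellipticPeriod hτ₁).homRat_eq_bot_of_card_ne hY fun h ↦ hcard h.symm
  rcases IsAbelianVariety.exists_algHom_center_endAlgRat_or_isIsogenous_of_hodgeGroupC_prod_ellipticPeriod_prod_ellipticPeriod_ne
      hτ₃ hτ₂ (IsAbelianVariety.prod ⟨η, hη⟩ (isAbelianVariety_ellipticPeriod hτ₁)) h₁₂' h₂₁' hCM hne with ⟨χ₁, hτχ₁⟩ | h
  · -- a character of `Z(End⁰(Y × E₁)) = Z(End⁰ Y) × End⁰(E₁)` with value `τ₃`
    rcases exists_algHom_center_or_of_mem_range_algHom_center_of_algEquiv_prod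
        (ComplexTorus.endAlgRatProdEquiv Ψ (ellipticPeriod hτ₁) hY1 h1Y) χ₁ hτχ₁ with ⟨χ, hχ⟩ | ⟨χ, hχ⟩
    · exact hY.not_mem_range_algHom_center_endAlgRat_of_finrank_eq_two hτ₃ hη h2 hCM χ hχ
    · exact h₁₃ (isIsogenous_ellipticPeriod_of_mem_range_algHom_center_endAlgRat hτ₁ hτ₃ χ hχ)
  · exact h₂₃ h

/-- **`((Y × E₁) × E₂) × E₃` SATISFIES CONDITION (D) for a SIMPLE polarised abelian surface `Y` and ALL elliptic curves
`E_i = E_{τ_i}`**: `E₃` without complex multiplication — the non-CM elliptic factor theorem on the stably nondegenerate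
`(Y × E₁) × E₂`; two of the curves isogenous — `X ∼ (Y × E_j) × E_k²`, «reduced to the case `dim(X) ≤ 4`» by Hazama's power
remark; otherwise the Hodge group splits off `Hg(E₃)` (previous theorem) and (D) transfers from `(Y × E₁) × E₂` and `E₃`.
[cite: MoonenZarhin1999LowDim, Thm. (0.2) (4) (p0002 L1–L8) and §5 (5.11) (p0010 L47–L56), §3 (3.1), (3.4), Prop. (3.8)]
[cite: Gordon1999HodgeAVSurvey, 7.6.1–7.6.2] -/
theorem IsSimple.forall_divisorClasses_powPeriod_prod_ellipticPeriod_prod_ellipticPeriod_prod_ellipticPeriod_eq_hodgeClasses_of_finrank_eq_two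
    (hY : IsSimple Ψ) (hη : IsRiemannForm Ψ η) (h2 : finrank ℂ E = 2) :
    ∀ k p, divisorClasses (powPeriod (prodPeriod (prodPeriod (prodPeriod Ψ (ellipticPeriod hτ₁)) (ellipticPeriod hτ₂))
        (ellipticPeriod hτ₃)) k) p =
      hodgeClasses (powPeriod (prodPeriod (prodPeriod (prodPeriod Ψ (ellipticPeriod hτ₁)) (ellipticPeriod hτ₂))
        (ellipticPeriod hτ₃)) k) p := by
  have hAY : IsAbelianVariety Ψ := ⟨η, hη⟩
  -- every `(Y × E_σ) × E_ρ` is stably nondegenerate (g51-#6)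
  have h4 : ∀ {σ ρ : ℂ} (hσ : σ.im ≠ 0) (hρ : ρ.im ≠ 0),
      ∀ k p, divisorClasses (powPeriod (prodPeriod (prodPeriod Ψ (ellipticPeriod hσ)) (ellipticPeriod hρ)) k) p =
        hodgeClasses (powPeriod (prodPeriod (prodPeriod Ψ (ellipticPeriod hσ)) (ellipticPeriod hρ)) k) p :=
    fun hσ hρ ↦ hη.forall_divisorClasses_powPeriod_prod_ellipticPeriod_prod_ellipticPeriod_eq_hodgeClasses_of_finrank_eq_two
      hσ hρ h2
  by_cases hE : ellipticEnd hτ₃ = ⊥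
  · exact ((hAY.prod (isAbelianVariety_ellipticPeriod hτ₁)).prod (isAbelianVariety_ellipticPeriod hτ₂))
      |>.forall_divisorClasses_powPeriod_prod_ellipticPeriod_eq_hodgeClasses_of_ellipticEnd_eq_bot hτ₃ hE (h4 hτ₁ hτ₂)
  by_cases h₁₃ : IsIsogenous (ellipticPeriod hτ₁) (ellipticPeriod hτ₃)
  · -- `X ≅ ((Y × E₂) × E₁) × E₃ ≅ (Y × E₂) × (E₁ × E₃) ∼ (Y × E₂) × E₃²`
    exact (((isIsomorphic_prod_prod_swap₅₅ Ψ (ellipticPeriod hτ₁) (ellipticPeriod hτ₂)).prod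
        (IsIsomorphic.refl (ellipticPeriod hτ₃))).trans
      (isIsomorphic_prodPeriod_assoc (prodPeriod Ψ (ellipticPeriod hτ₂)) (ellipticPeriod hτ₁) (ellipticPeriod hτ₃)))
      |>.isIsogenous.forall_powPeriod_divisorClasses_eq_hodgeClasses_iff.2
        (forall_divisorClasses_powPeriod_prod_prod_eq_hodgeClasses_of_isIsogenous₅₅
          (hAY.prod (isAbelianVariety_ellipticPeriod hτ₂)) hτ₁ hτ₃ h₁₃ (h4 hτ₂ hτ₃))
  by_cases h₂₃ : IsIsogenous (ellipticPeriod hτ₂) (ellipticPeriod hτ₃)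
  · -- `X ≅ (Y × E₁) × (E₂ × E₃) ∼ (Y × E₁) × E₃²`
    exact (isIsomorphic_prodPeriod_assoc (prodPeriod Ψ (ellipticPeriod hτ₁)) (ellipticPeriod hτ₂) (ellipticPeriod hτ₃))
      |>.isIsogenous.forall_powPeriod_divisorClasses_eq_hodgeClasses_iff.2
        (forall_divisorClasses_powPeriod_prod_prod_eq_hodgeClasses_of_isIsogenous₅₅
          (hAY.prod (isAbelianVariety_ellipticPeriod hτ₁)) hτ₂ hτ₃ h₂₃ (h4 hτ₁ hτ₃))
  by_cases h₁₂ : IsIsogenous (ellipticPeriod hτ₁) (ellipticPeriod hτ₂)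
  · -- `X ≅ ((Y × E₁) × E₃) × E₂ ≅ ((Y × E₃) × E₁) × E₂ ≅ (Y × E₃) × (E₁ × E₂) ∼ (Y × E₃) × E₂²`
    exact (((isIsomorphic_prod_prod_swap₅₅ (prodPeriod Ψ (ellipticPeriod hτ₁)) (ellipticPeriod hτ₂)
          (ellipticPeriod hτ₃)).trans
        ((isIsomorphic_prod_prod_swap₅₅ Ψ (ellipticPeriod hτ₁) (ellipticPeriod hτ₃)).prod
          (IsIsomorphic.refl (ellipticPeriod hτ₂)))).trans
      (isIsomorphic_prodPeriod_assoc (prodPeriod Ψ (ellipticPeriod hτ₃)) (ellipticPeriod hτ₁) (ellipticPeriod hτ₂)))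
      |>.isIsogenous.forall_powPeriod_divisorClasses_eq_hodgeClasses_iff.2
        (forall_divisorClasses_powPeriod_prod_prod_eq_hodgeClasses_of_isIsogenous₅₅
          (hAY.prod (isAbelianVariety_ellipticPeriod hτ₃)) hτ₁ hτ₂ h₁₂ (h4 hτ₃ hτ₂))
  · -- three pairwise non-isogenous curves, `E₃` with complex multiplication: the Hodge group splits
    exact forall_divisorClasses_powPeriod_prod_eq_hodgeClasses_of_hodgeGroupC_prod_eq
      (hY.hodgeGroupC_prod_ellipticPeriod_prod_ellipticPeriod_prod_ellipticPeriod_eq_blockDiagProd hτ₁ hτ₂ hτ₃ hη h2 hE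
        h₁₂ h₁₃ h₂₃)
      (h4 hτ₁ hτ₂) (fun k p ↦ divisorClasses_eq_hodgeClasses_ellipticPow hτ₃ k p)

/-- **MOONEN–ZARHIN THM. (0.2) (4) FOR `Y × E₁ × E₂ × E₃`: `((Y × E_{τ₁}) × E_{τ₂}) × E_{τ₃}` SATISFIES CONDITION (D) —
`ℬ•(Xⁿ) = 𝒟•(Xⁿ)` for all `n` — FOR EVERY POLARISED COMPLEX ABELIAN SURFACE `Y` AND ALL ELLIPTIC CURVES `E_{τ₁}`, `E_{τ₂}`,
`E_{τ₃}`** (no exceptional case: all simple factors have dimension `≤ 2`, so `X` is in none of (e), (f), (g) and has no simple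
factor of dimension `4`; a non-simple `Y ∼ E_{σ₀} × E_{σ₁}` makes `X` a product of five elliptic curves, Cor. (3.9)).
[cite: MoonenZarhin1999LowDim, Thm. (0.2) (4) (p0002 L1–L8), cases (e)–(g) (p0001 L127–L140), §5 (5.11) (p0010 L47–L56) and §3 Cor. (3.9) (p0007 L80–L84)]
[cite: Gordon1999HodgeAVSurvey, Thm. 7.5 and 7.6.1–7.6.2] -/
theorem IsRiemannForm.forall_divisorClasses_powPeriod_prod_ellipticPeriod_prod_ellipticPeriod_prod_ellipticPeriod_eq_hodgeClasses_of_finrank_eq_two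
    (hη : IsRiemannForm Ψ η) (h2 : finrank ℂ E = 2) :
    ∀ k p, divisorClasses (powPeriod (prodPeriod (prodPeriod (prodPeriod Ψ (ellipticPeriod hτ₁)) (ellipticPeriod hτ₂))
        (ellipticPeriod hτ₃)) k) p =
      hodgeClasses (powPeriod (prodPeriod (prodPeriod (prodPeriod Ψ (ellipticPeriod hτ₁)) (ellipticPeriod hτ₂))
        (ellipticPeriod hτ₃)) k) p := by
  by_cases hY : IsSimple Ψ
  · exact hY.forall_divisorClasses_powPeriod_prod_ellipticPeriod_prod_ellipticPeriod_prod_ellipticPeriod_eq_hodgeClasses_of_finrank_eq_two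
      hτ₁ hτ₂ hτ₃ hη h2
  · -- `Y ∼ E_{σ₀} × E_{σ₁}`: a product of five elliptic curves
    obtain ⟨σ, hσ, hYσ⟩ := hη.exists_isIsogenous_piPeriod_ellipticPeriod_of_not_isSimple_of_finrank_eq_two h2 hY
    have h₁ := isIsogenous_prod_ellipticPeriod_piPeriod_snoc₅₅ hσ hτ₁ hYσ
    have h₂ := isIsogenous_prod_ellipticPeriod_piPeriod_snoc₅₅ (forall_im_snoc_ne_zero₅₅ hσ hτ₁) hτ₂ h₁
    have h₃ := isIsogenous_prod_ellipticPeriod_piPeriod_snoc₅₅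
      (forall_im_snoc_ne_zero₅₅ (forall_im_snoc_ne_zero₅₅ hσ hτ₁) hτ₂) hτ₃ h₂
    exact h₃.forall_divisorClasses_powPeriod_eq_hodgeClasses_of_pi_ellipticPeriod
      (forall_im_snoc_ne_zero₅₅ (forall_im_snoc_ne_zero₅₅ (forall_im_snoc_ne_zero₅₅ hσ hτ₁) hτ₂) hτ₃)

/-- The `IsAbelianVariety` form: `((Y × E_{τ₁}) × E_{τ₂}) × E_{τ₃}` satisfies (D) for every complex abelian surface `Y`.
[cite: MoonenZarhin1999LowDim, Thm. (0.2) (4) (p0002 L1–L8) and §5 (5.11) (p0010 L47–L56)] -/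
theorem IsAbelianVariety.forall_divisorClasses_powPeriod_prod_ellipticPeriod_prod_ellipticPeriod_prod_ellipticPeriod_eq_hodgeClasses_of_finrank_eq_two
    (hA : IsAbelianVariety Ψ) (h2 : finrank ℂ E = 2) :
    ∀ k p, divisorClasses (powPeriod (prodPeriod (prodPeriod (prodPeriod Ψ (ellipticPeriod hτ₁)) (ellipticPeriod hτ₂))
        (ellipticPeriod hτ₃)) k) p =
      hodgeClasses (powPeriod (prodPeriod (prodPeriod (prodPeriod Ψ (ellipticPeriod hτ₁)) (ellipticPeriod hτ₂))
        (ellipticPeriod hτ₃)) k) p := by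
  obtain ⟨η, hη⟩ := hA
  exact hη.forall_divisorClasses_powPeriod_prod_ellipticPeriod_prod_ellipticPeriod_prod_ellipticPeriod_eq_hodgeClasses_of_finrank_eq_two
    hτ₁ hτ₂ hτ₃ h2

end SurfaceThreeCurves

section SurfaceThreeCurvesIsogenous

variable {ι ι₁ ι₂ ι₃ : Type*} [Fintype ι] [Fintype ι₁] [Fintype ι₂] [Fintype ι₃] [DecidableEq ι] [DecidableEq ι₁]
  [DecidableEq ι₂] [DecidableEq ι₃] {F F₁ F₂ F₃ : Type*} [NormedAddCommGroup F] [NormedSpace ℂ F] [NormedAddCommGroup F₁]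
  [NormedSpace ℂ F₁] [NormedAddCommGroup F₂] [NormedSpace ℂ F₂] [NormedAddCommGroup F₃] [NormedSpace ℂ F₃]
  {Φ : (ι → ℝ) ≃L[ℝ] F} {Θ₁ : (ι₁ → ℝ) ≃L[ℝ] F₁} {Θ₂ : (ι₂ → ℝ) ≃L[ℝ] F₂} {Θ₃ : (ι₃ → ℝ) ≃L[ℝ] F₃}
  {κ : Type} [Fintype κ] [DecidableEq κ] {E : Type} [NormedAddCommGroup E] [NormedSpace ℂ E] [FiniteDimensional ℂ E]
  {Ψ : (κ → ℝ) ≃L[ℝ] E} {η : E [⋀^Fin 2]→L[ℝ] ℝ}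

/-- **EVERY COMPLEX TORUS ISOGENOUS TO `((Y × C₁) × C₂) × C₃` WITH `Y` A POLARISED ABELIAN SURFACE AND `C₁`, `C₂`, `C₃`
ONE-DIMENSIONAL COMPLEX TORI SATISFIES CONDITION (D)** (`C_i ≅ E_{τ_i}`; (D) is an isogeny invariant).
[cite: MoonenZarhin1999LowDim, Thm. (0.2) (4) (p0002 L1–L8) and §5 (5.11) (p0010 L47–L56)] [cite: Lange2023AbelianVarietiesComplex, §1.1.2 Cor. 1.1.16] -/
theorem IsIsogenous.forall_divisorClasses_powPeriod_eq_hodgeClasses_of_prod_prod_prod_of_finrank_eq_one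
    (hiso : IsIsogenous Φ (prodPeriod (prodPeriod (prodPeriod Ψ Θ₁) Θ₂) Θ₃)) (hη : IsRiemannForm Ψ η) (h2 : finrank ℂ E = 2)
    (h₁ : finrank ℂ F₁ = 1) (h₂ : finrank ℂ F₂ = 1) (h₃ : finrank ℂ F₃ = 1) :
    ∀ k p, divisorClasses (powPeriod Φ k) p = hodgeClasses (powPeriod Φ k) p := by
  obtain ⟨τ₁, hτ₁, e₁⟩ := exists_isIsomorphic_ellipticPeriod Θ₁ h₁
  obtain ⟨τ₂, hτ₂, e₂⟩ := exists_isIsomorphic_ellipticPeriod Θ₂ h₂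
  obtain ⟨τ₃, hτ₃, e₃⟩ := exists_isIsomorphic_ellipticPeriod Θ₃ h₃
  exact (IsIsogenous.trans _ _ _ hiso ((((IsIsomorphic.refl Ψ).prod e₁).prod e₂).prod e₃).isIsogenous)
    |>.forall_powPeriod_divisorClasses_eq_hodgeClasses_iff.2
      (hη.forall_divisorClasses_powPeriod_prod_ellipticPeriod_prod_ellipticPeriod_prod_ellipticPeriod_eq_hodgeClasses_of_finrank_eq_two
        hτ₁ hτ₂ hτ₃ h2)

/-- The same read for `X = ((Y × C₁) × C₂) × C₃` itself: (D) for every polarised abelian surface `Y` and all one-dimensional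
complex tori `C₁, C₂, C₃`. [cite: MoonenZarhin1999LowDim, Thm. (0.2) (4) (p0002 L1–L8)] -/
theorem IsRiemannForm.forall_divisorClasses_powPeriod_prod_prod_prod_eq_hodgeClasses_of_finrank_eq_two_of_finrank_eq_one
    (hη : IsRiemannForm Ψ η) (h2 : finrank ℂ E = 2) (h₁ : finrank ℂ F₁ = 1) (h₂ : finrank ℂ F₂ = 1)
    (h₃ : finrank ℂ F₃ = 1) :
    ∀ k p, divisorClasses (powPeriod (prodPeriod (prodPeriod (prodPeriod Ψ Θ₁) Θ₂) Θ₃) k) p =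
      hodgeClasses (powPeriod (prodPeriod (prodPeriod (prodPeriod Ψ Θ₁) Θ₂) Θ₃) k) p :=
  (IsIsogenous.refl _).forall_divisorClasses_powPeriod_eq_hodgeClasses_of_prod_prod_prod_of_finrank_eq_one hη h2 h₁ h₂ h₃

/-- **«`Hg(X) = Sp_D(V,φ)`» FOR `X ∼ ((Y × C₁) × C₂) × C₃`** (real points `Hg(X)(ℝ) = S(X)(ℝ)`, the full centraliser of
`End⁰(X)` in the symplectic group of ANY polarisation `ω` of `X`) — from (D) by Gordon's Thm. 7.5 (1) ⟹ (2) (the tree's A4-103).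
[cite: MoonenZarhin1999LowDim, Thm. (0.2) (4) (p0002 L5–L8: «then `Hg(X) = Sp_D(V,φ)`»)] [cite: Gordon1999HodgeAVSurvey, Thm. 7.5 (1) ⟺ (2)]
[cite: Milne1999LefschetzClasses, §4 Prop. 4.8] -/
theorem IsRiemannForm.hodgeGroup_eq_lefschetzGroup_of_isIsogenous_prod_prod_prod_of_finrank_eq_one {ι' : Type} [Fintype ι']
    [DecidableEq ι'] {F' : Type} [NormedAddCommGroup F'] [NormedSpace ℂ F'] [FiniteDimensional ℂ F']
    {Φ' : (ι' → ℝ) ≃L[ℝ] F'} {ω : F' [⋀^Fin 2]→L[ℝ] ℝ} (hω : IsRiemannForm Φ' ω)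
    (hiso : IsIsogenous Φ' (prodPeriod (prodPeriod (prodPeriod Ψ Θ₁) Θ₂) Θ₃)) (hη : IsRiemannForm Ψ η) (h2 : finrank ℂ E = 2)
    (h₁ : finrank ℂ F₁ = 1) (h₂ : finrank ℂ F₂ = 1) (h₃ : finrank ℂ F₃ = 1) : hodgeGroup Φ' = lefschetzGroup Φ' ω := by
  obtain ⟨G, hG⟩ := hω.exists_ratMatrix_latticeGram
  have h0 : 0 < finrank ℂ F' := by
    have hc := hiso.card_eq
    rw [Fintype.card_sum, Fintype.card_sum, Fintype.card_sum, card_eq_two_mul_finrank Φ', card_eq_two_mul_finrank Ψ,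
      h2] at hc
    omega
  exact ((hω.forall_divisorClasses_powPeriod_eq_hodgeClasses_iff_eq_and_hodgeGroup_eq_lefschetzGroup hG h0).1
    (hiso.forall_divisorClasses_powPeriod_eq_hodgeClasses_of_prod_prod_prod_of_finrank_eq_one hη h2 h₁ h₂ h₃)).2

end SurfaceThreeCurvesIsogenous

/-! ## §2 `(Y₁ × Y₂) × E` for two abelian surfaces `Y₁`, `Y₂` and an elliptic curve `E` -/

section TwoSurfacesCurve

variable {κ₁ κ₂ : Type} [Fintype κ₁] [Fintype κ₂] [DecidableEq κ₁] [DecidableEq κ₂] {E₁ E₂ : Type}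
  [NormedAddCommGroup E₁] [NormedSpace ℂ E₁] [FiniteDimensional ℂ E₁] [NormedAddCommGroup E₂] [NormedSpace ℂ E₂]
  [FiniteDimensional ℂ E₂] {Ψ₁ : (κ₁ → ℝ) ≃L[ℝ] E₁} {Ψ₂ : (κ₂ → ℝ) ≃L[ℝ] E₂} {η₁ : E₁ [⋀^Fin 2]→L[ℝ] ℝ}
  {η₂ : E₂ [⋀^Fin 2]→L[ℝ] ℝ} {τ : ℂ} (hτ : τ.im ≠ 0)

/-- **MOONEN–ZARHIN (5.11) WITH `d_max ≤ 2`, THE HODGE GROUP, TWO SIMPLE SURFACES: for NON-ISOGENOUS SIMPLE abelian surfaces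
`Y₁`, `Y₂` and an elliptic curve `E` WITH complex multiplication, `Hg((Y₁ × Y₂) × E)(ℂ) = Hg(Y₁ × Y₂)(ℂ) × Hg(E)(ℂ)`** —
`End⁰(Y₁ × Y₂) = End⁰(Y₁) × End⁰(Y₂)` and `k = End⁰(E)` embeds into neither centre, so «Proposition (3.8) gives
`Hg(X) = Hg(E) × Hg(Y)`». [cite: MoonenZarhin1999LowDim, §5 (5.11) (p0010 L47–L56) and §3 Prop. (3.8) (p0007 L55–L74)]
[cite: Lange2023AbelianVarietiesComplex, §2.4.4 Cor. 2.4.26] -/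
theorem IsSimple.hodgeGroupC_prod_prod_ellipticPeriod_eq_blockDiagProd_of_not_isIsogenous (hY₁ : IsSimple Ψ₁)
    (hY₂ : IsSimple Ψ₂) (hη₁ : IsRiemannForm Ψ₁ η₁) (hη₂ : IsRiemannForm Ψ₂ η₂) (h2₁ : finrank ℂ E₁ = 2)
    (h2₂ : finrank ℂ E₂ = 2) (hCM : ellipticEnd hτ ≠ ⊥) (hni : ¬ IsIsogenous Ψ₁ Ψ₂) :
    hodgeGroupC (prodPeriod (prodPeriod Ψ₁ Ψ₂) (ellipticPeriod hτ)) =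
      blockDiagProd (hodgeGroupC (prodPeriod Ψ₁ Ψ₂)) (hodgeGroupC (ellipticPeriod hτ)) := by
  by_contra hne
  have hni' : ¬ IsIsogenous Ψ₂ Ψ₁ := fun h ↦ hni (IsIsogenous.symm _ _ h)
  rcases IsAbelianVariety.exists_algHom_center_endAlgRat_or_of_hodgeGroupC_prod_prod_ellipticPeriod_ne hτ ⟨η₁, hη₁⟩ ⟨η₂, hη₂⟩
      (hY₁.homRat_eq_bot hY₂ hni) (hY₂.homRat_eq_bot hY₁ hni') hCM hne with ⟨χ, hχ⟩ | ⟨χ, hχ⟩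
  · exact hY₁.not_mem_range_algHom_center_endAlgRat_of_finrank_eq_two hτ hη₁ h2₁ hCM χ hχ
  · exact hY₂.not_mem_range_algHom_center_endAlgRat_of_finrank_eq_two hτ hη₂ h2₂ hCM χ hχ

/-- `(Y₁ × Y₂) × E_τ` satisfies (D) when `Y₁` is NOT simple: `Y₁ ∼ E_a × E_b` and `(Y₁ × Y₂) × E_τ ∼ ((Y₂ × E_a) × E_b) × E_τ`
(§1). [cite: MoonenZarhin1999LowDim, Thm. (0.2) (4) (p0002 L1–L8) and §5 (5.11) (p0010 L47–L56)] [cite: Lange2023AbelianVarietiesComplex, §2.4.4 Thm. 2.4.25 and §1.1.2 Cor. 1.1.16] -/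
private theorem forall_divisorClasses_powPeriod_prod_prod_ellipticPeriod_eq_hodgeClasses_of_not_isSimple₅₅
    (hη₁ : IsRiemannForm Ψ₁ η₁) (hη₂ : IsRiemannForm Ψ₂ η₂) (h2₁ : finrank ℂ E₁ = 2) (h2₂ : finrank ℂ E₂ = 2)
    (hY₁ : ¬ IsSimple Ψ₁) :
    ∀ k p, divisorClasses (powPeriod (prodPeriod (prodPeriod Ψ₁ Ψ₂) (ellipticPeriod hτ)) k) p =
      hodgeClasses (powPeriod (prodPeriod (prodPeriod Ψ₁ Ψ₂) (ellipticPeriod hτ)) k) p := by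
  obtain ⟨V, hV, hVc, hW, hWc, hrV, hrW, hiso, -⟩ := hη₁.exists_isIsogenous_prod_elliptic_of_not_isSimple h2₁ hY₁
  have hdV : finrank ℂ (cxSpan Ψ₁ V) = 1 := by
    have h := subRank_eq_two_mul_finrank Ψ₁ hV hVc
    omega
  have hdW : finrank ℂ (cxSpan Ψ₁ (orthSubspace Ψ₁ η₁ V)) = 1 := by
    have h := subRank_eq_two_mul_finrank Ψ₁ hW hWc
    omega
  obtain ⟨a, ha, ea⟩ := exists_isIsomorphic_ellipticPeriod (subtorusPeriod Ψ₁ V hV hVc) hdV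
  obtain ⟨b, hb, eb⟩ := exists_isIsomorphic_ellipticPeriod (subtorusPeriod Ψ₁ (orthSubspace Ψ₁ η₁ V) hW hWc) hdW
  -- `Y₁ ∼ E_a × E_b`, so `(Y₁ × Y₂) × E_τ ∼ ((E_a × E_b) × Y₂) × E_τ ≅ ((Y₂ × E_a) × E_b) × E_τ`
  have hY₁ab : IsIsogenous Ψ₁ (prodPeriod (ellipticPeriod ha) (ellipticPeriod hb)) :=
    IsIsogenous.trans _ _ _ hiso (ea.prod eb).isIsogenous
  have hX : IsIsogenous (prodPeriod (prodPeriod Ψ₁ Ψ₂) (ellipticPeriod hτ))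
      (prodPeriod (prodPeriod (prodPeriod Ψ₂ (ellipticPeriod ha)) (ellipticPeriod hb)) (ellipticPeriod hτ)) :=
    IsIsogenous.trans _ _ _ ((hY₁ab.prod (IsIsogenous.refl Ψ₂)).prod (IsIsogenous.refl (ellipticPeriod hτ)))
      ((((isIsomorphic_prodPeriod_comm (prodPeriod (ellipticPeriod ha) (ellipticPeriod hb)) Ψ₂).trans
        (isIsomorphic_prodPeriod_assoc Ψ₂ (ellipticPeriod ha) (ellipticPeriod hb)).symm).prod
          (IsIsomorphic.refl (ellipticPeriod hτ))).isIsogenous)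
  exact hX.forall_powPeriod_divisorClasses_eq_hodgeClasses_iff.2
    (hη₂.forall_divisorClasses_powPeriod_prod_ellipticPeriod_prod_ellipticPeriod_prod_ellipticPeriod_eq_hodgeClasses_of_finrank_eq_two
      ha hb hτ h2₂)

/-- **MOONEN–ZARHIN THM. (0.2) (4) FOR `(Y₁ × Y₂) × E`: `(Y₁ × Y₂) × E_τ` SATISFIES CONDITION (D) — `ℬ•(Xⁿ) = 𝒟•(Xⁿ)` for all
`n` — FOR ALL POLARISED COMPLEX ABELIAN SURFACES `Y₁`, `Y₂` AND EVERY ELLIPTIC CURVE `E_τ`** (no exceptional case): `E_τ`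
without complex multiplication — the non-CM elliptic factor theorem on `Y₁ × Y₂` (stably nondegenerate, Thm. (0.1) (4) for
two surfaces); a non-simple `Y_i` — §1; `Y₁ ∼ Y₂` simple — `X ∼ E_τ × Y₂²`, «every simple factor … with multiplicity 1»;
two non-isogenous simple surfaces and `E_τ` CM — the Hodge group splits (previous theorem) and (D) transfers.
[cite: MoonenZarhin1999LowDim, Thm. (0.2) (4) (p0002 L1–L8), §5 (5.11) (p0010 L47–L56), (5.6) (p0009 L113–L114), §3 (3.1), Prop. (3.8)]
[cite: Gordon1999HodgeAVSurvey, Thm. 7.5 and 7.6.1–7.6.2] -/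
theorem IsRiemannForm.forall_divisorClasses_powPeriod_prod_prod_ellipticPeriod_eq_hodgeClasses_of_finrank_eq_two_two
    (hη₁ : IsRiemannForm Ψ₁ η₁) (hη₂ : IsRiemannForm Ψ₂ η₂) (h2₁ : finrank ℂ E₁ = 2) (h2₂ : finrank ℂ E₂ = 2) :
    ∀ k p, divisorClasses (powPeriod (prodPeriod (prodPeriod Ψ₁ Ψ₂) (ellipticPeriod hτ)) k) p =
      hodgeClasses (powPeriod (prodPeriod (prodPeriod Ψ₁ Ψ₂) (ellipticPeriod hτ)) k) p := by
  haveI : Nonempty κ₁ := Fintype.card_pos_iff.1 (by rw [card_eq_two_mul_finrank Ψ₁, h2₁]; norm_num)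
  haveI : Nonempty κ₂ := Fintype.card_pos_iff.1 (by rw [card_eq_two_mul_finrank Ψ₂, h2₂]; norm_num)
  have hSN₁₂ := hη₁.forall_divisorClasses_powPeriod_prod_eq_hodgeClasses_of_finrank_eq_two hη₂ h2₁ h2₂
  have hA₁₂ : IsAbelianVariety (prodPeriod Ψ₁ Ψ₂) := IsAbelianVariety.prod ⟨η₁, hη₁⟩ ⟨η₂, hη₂⟩
  by_cases hE : ellipticEnd hτ = ⊥
  · exact hA₁₂.forall_divisorClasses_powPeriod_prod_ellipticPeriod_eq_hodgeClasses_of_ellipticEnd_eq_bot hτ hE hSN₁₂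
  by_cases hY₁ : IsSimple Ψ₁
  swap
  · exact forall_divisorClasses_powPeriod_prod_prod_ellipticPeriod_eq_hodgeClasses_of_not_isSimple₅₅ hτ hη₁ hη₂ h2₁ h2₂ hY₁
  by_cases hY₂ : IsSimple Ψ₂
  swap
  · -- `(Y₁ × Y₂) × E ≅ (Y₂ × Y₁) × E`
    exact ((isIsomorphic_prodPeriod_comm Ψ₁ Ψ₂).prod (IsIsomorphic.refl (ellipticPeriod hτ)))
      |>.isIsogenous.forall_powPeriod_divisorClasses_eq_hodgeClasses_iff.2
        (forall_divisorClasses_powPeriod_prod_prod_ellipticPeriod_eq_hodgeClasses_of_not_isSimple₅₅ hτ hη₂ hη₁ h2₂ h2₁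
          hY₂)
  by_cases hi : IsIsogenous Ψ₁ Ψ₂
  · -- `(Y₁ × Y₂) × E ∼ Y₂² × E ≅ E × Y₂²`, stably nondegenerate with `E × Y₂`
    have hSN₂E : ∀ k p, divisorClasses (powPeriod (prodPeriod (ellipticPeriod hτ) Ψ₂) k) p =
        hodgeClasses (powPeriod (prodPeriod (ellipticPeriod hτ) Ψ₂) k) p :=
      (isIsomorphic_prodPeriod_comm Ψ₂ (ellipticPeriod hτ)).isIsogenous.forall_powPeriod_divisorClasses_eq_hodgeClasses_iff.1
        (hη₂.forall_divisorClasses_powPeriod_prod_ellipticPeriod_eq_hodgeClasses_of_finrank_eq_two hτ h2₂)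
    exact (IsIsogenous.trans _ _ _ ((hi.prod_powPeriod_two (IsIsogenous.refl Ψ₂)).prod (IsIsogenous.refl (ellipticPeriod hτ)))
        (isIsomorphic_prodPeriod_comm (powPeriod Ψ₂ 2) (ellipticPeriod hτ)).isIsogenous)
      |>.forall_powPeriod_divisorClasses_eq_hodgeClasses_iff.2
        ((isAbelianVariety_ellipticPeriod hτ).forall_divisorClasses_powPeriod_prod_powPeriod_eq_hodgeClasses_of_prod
          ⟨η₂, hη₂⟩ hSN₂E 2)
  · -- two non-isogenous simple surfaces and a CM curve: the Hodge group splits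
    exact forall_divisorClasses_powPeriod_prod_eq_hodgeClasses_of_hodgeGroupC_prod_eq
      (hY₁.hodgeGroupC_prod_prod_ellipticPeriod_eq_blockDiagProd_of_not_isIsogenous hτ hY₂ hη₁ hη₂ h2₁ h2₂ hE hi) hSN₁₂
      (fun k p ↦ divisorClasses_eq_hodgeClasses_ellipticPow hτ k p)

/-- The `IsAbelianVariety` form: `(Y₁ × Y₂) × E_τ` satisfies (D) for all complex abelian surfaces `Y₁`, `Y₂` and every `τ`.
[cite: MoonenZarhin1999LowDim, Thm. (0.2) (4) (p0002 L1–L8) and §5 (5.11) (p0010 L47–L56)] -/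
theorem IsAbelianVariety.forall_divisorClasses_powPeriod_prod_prod_ellipticPeriod_eq_hodgeClasses_of_finrank_eq_two_two
    (hA₁ : IsAbelianVariety Ψ₁) (hA₂ : IsAbelianVariety Ψ₂) (h2₁ : finrank ℂ E₁ = 2) (h2₂ : finrank ℂ E₂ = 2) :
    ∀ k p, divisorClasses (powPeriod (prodPeriod (prodPeriod Ψ₁ Ψ₂) (ellipticPeriod hτ)) k) p =
      hodgeClasses (powPeriod (prodPeriod (prodPeriod Ψ₁ Ψ₂) (ellipticPeriod hτ)) k) p := by
  obtain ⟨η₁, hη₁⟩ := hA₁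
  obtain ⟨η₂, hη₂⟩ := hA₂
  exact hη₁.forall_divisorClasses_powPeriod_prod_prod_ellipticPeriod_eq_hodgeClasses_of_finrank_eq_two_two hτ hη₂ h2₁ h2₂

end TwoSurfacesCurve

section TwoSurfacesCurveIsogenous

variable {ι ι₃ : Type*} [Fintype ι] [Fintype ι₃] [DecidableEq ι] [DecidableEq ι₃] {F F₃ : Type*} [NormedAddCommGroup F]
  [NormedSpace ℂ F] [NormedAddCommGroup F₃] [NormedSpace ℂ F₃] {Φ : (ι → ℝ) ≃L[ℝ] F} {Θ : (ι₃ → ℝ) ≃L[ℝ] F₃}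
  {κ₁ κ₂ : Type} [Fintype κ₁] [Fintype κ₂] [DecidableEq κ₁] [DecidableEq κ₂] {E₁ E₂ : Type}
  [NormedAddCommGroup E₁] [NormedSpace ℂ E₁] [FiniteDimensional ℂ E₁] [NormedAddCommGroup E₂] [NormedSpace ℂ E₂]
  [FiniteDimensional ℂ E₂] {Ψ₁ : (κ₁ → ℝ) ≃L[ℝ] E₁} {Ψ₂ : (κ₂ → ℝ) ≃L[ℝ] E₂} {η₁ : E₁ [⋀^Fin 2]→L[ℝ] ℝ}
  {η₂ : E₂ [⋀^Fin 2]→L[ℝ] ℝ}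

/-- **EVERY COMPLEX TORUS ISOGENOUS TO `(Y₁ × Y₂) × C` WITH `Y₁`, `Y₂` POLARISED ABELIAN SURFACES AND `C` A ONE-DIMENSIONAL
COMPLEX TORUS SATISFIES CONDITION (D).** [cite: MoonenZarhin1999LowDim, Thm. (0.2) (4) (p0002 L1–L8) and §5 (5.11) (p0010 L47–L56)]
[cite: Lange2023AbelianVarietiesComplex, §1.1.2 Cor. 1.1.16] -/
theorem IsIsogenous.forall_divisorClasses_powPeriod_eq_hodgeClasses_of_prod_prod_of_finrank_eq_two_two_one
    (hiso : IsIsogenous Φ (prodPeriod (prodPeriod Ψ₁ Ψ₂) Θ)) (hη₁ : IsRiemannForm Ψ₁ η₁) (hη₂ : IsRiemannForm Ψ₂ η₂)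
    (h2₁ : finrank ℂ E₁ = 2) (h2₂ : finrank ℂ E₂ = 2) (h₃ : finrank ℂ F₃ = 1) :
    ∀ k p, divisorClasses (powPeriod Φ k) p = hodgeClasses (powPeriod Φ k) p := by
  obtain ⟨τ, hτ, e⟩ := exists_isIsomorphic_ellipticPeriod Θ h₃
  exact (IsIsogenous.trans _ _ _ hiso ((IsIsomorphic.refl (prodPeriod Ψ₁ Ψ₂)).prod e).isIsogenous)
    |>.forall_powPeriod_divisorClasses_eq_hodgeClasses_iff.2
      (hη₁.forall_divisorClasses_powPeriod_prod_prod_ellipticPeriod_eq_hodgeClasses_of_finrank_eq_two_two hτ hη₂ h2₁ h2₂)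

/-- The same read for `X = (Y₁ × Y₂) × C` itself. [cite: MoonenZarhin1999LowDim, Thm. (0.2) (4) (p0002 L1–L8)] -/
theorem IsRiemannForm.forall_divisorClasses_powPeriod_prod_prod_eq_hodgeClasses_of_finrank_eq_two_two_one
    (hη₁ : IsRiemannForm Ψ₁ η₁) (hη₂ : IsRiemannForm Ψ₂ η₂) (h2₁ : finrank ℂ E₁ = 2) (h2₂ : finrank ℂ E₂ = 2)
    (h₃ : finrank ℂ F₃ = 1) :
    ∀ k p, divisorClasses (powPeriod (prodPeriod (prodPeriod Ψ₁ Ψ₂) Θ) k) p =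
      hodgeClasses (powPeriod (prodPeriod (prodPeriod Ψ₁ Ψ₂) Θ) k) p :=
  (IsIsogenous.refl _).forall_divisorClasses_powPeriod_eq_hodgeClasses_of_prod_prod_of_finrank_eq_two_two_one hη₁ hη₂ h2₁
    h2₂ h₃

/-- **«`Hg(X) = Sp_D(V,φ)`» FOR `X ∼ (Y₁ × Y₂) × C`** (real points, any polarisation `ω` of `X`), from (D) by Gordon's
Thm. 7.5 (1) ⟹ (2). [cite: MoonenZarhin1999LowDim, Thm. (0.2) (4) (p0002 L5–L8)] [cite: Gordon1999HodgeAVSurvey, Thm. 7.5 (1) ⟺ (2)]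
[cite: Milne1999LefschetzClasses, §4 Prop. 4.8] -/
theorem IsRiemannForm.hodgeGroup_eq_lefschetzGroup_of_isIsogenous_prod_prod_of_finrank_eq_two_two_one {ι' : Type}
    [Fintype ι'] [DecidableEq ι'] {F' : Type} [NormedAddCommGroup F'] [NormedSpace ℂ F'] [FiniteDimensional ℂ F']
    {Φ' : (ι' → ℝ) ≃L[ℝ] F'} {ω : F' [⋀^Fin 2]→L[ℝ] ℝ} (hω : IsRiemannForm Φ' ω)
    (hiso : IsIsogenous Φ' (prodPeriod (prodPeriod Ψ₁ Ψ₂) Θ)) (hη₁ : IsRiemannForm Ψ₁ η₁) (hη₂ : IsRiemannForm Ψ₂ η₂)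
    (h2₁ : finrank ℂ E₁ = 2) (h2₂ : finrank ℂ E₂ = 2) (h₃ : finrank ℂ F₃ = 1) : hodgeGroup Φ' = lefschetzGroup Φ' ω := by
  obtain ⟨G, hG⟩ := hω.exists_ratMatrix_latticeGram
  have h0 : 0 < finrank ℂ F' := by
    have hc := hiso.card_eq
    rw [Fintype.card_sum, Fintype.card_sum, card_eq_two_mul_finrank Φ', card_eq_two_mul_finrank Ψ₁, h2₁] at hc
    omega
  exact ((hω.forall_divisorClasses_powPeriod_eq_hodgeClasses_iff_eq_and_hodgeGroup_eq_lefschetzGroup hG h0).1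
    (hiso.forall_divisorClasses_powPeriod_eq_hodgeClasses_of_prod_prod_of_finrank_eq_two_two_one hη₁ hη₂ h2₁ h2₂ h₃)).2

end TwoSurfacesCurveIsogenous

end ComplexTorus

end Literature.Geometry.Kaehler
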